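import Literature.MathematicalPhysics.QuantumFieldTheory.Balaban1983to89.B4RegionPairGreen

/-!
# `Balaban1983to89.B4CubeGreenRegionPair` — [Balaban1983RegularityDecay] THEOREM p. 573, (1.11)–(1.12) FOR A GENERAL
# PAIR `Ω ⊂ Ω₀`: THE TWO FAMILIES OF CUBE PROPAGATORS of the expansion (2.13) run simultaneously for `G_k(Ω₀,A)` and for
# `G_k(Ω,A) ⊕ G_k(Ω₀∖Ω,A)` (r01 g6's `B4Ineq112LpChain.ineq112_value_lp`): `G_j` (cut at `∂□_j`) and `G_j^Ω` (cut at
# `∂□_j` and across `∂Ω`), on the sites of `Ω₀`, for every cube and every configuration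

statement-level skeleton of published theorems with citation tags; proofs where landed; nothing here is a claim about the Yang–Mills mass gap

WHAT THIS FILE DOES.  Carrier `X₀ = fineDom n Ω₀c`, sub-region `Ωc ⊆ Ω₀c` (finite unions of `K`-blocks), cubes
`□̂_j` of side `2K`.  §1 the cube configurations with the switch ON `Ω`: `atField₂ j = Ã_j` (p35's `cubeField`) when
`□̂_j ⊆ Ω`, `= A` otherwise (the print takes `Ã_j` at every cube interior to `Ω₀`; at the cubes interior to `Ω₀` but
meeting `∂Ω` we keep `A` — the expansion (2.13) allows any choice with the letter bounds, and `A` there needs only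
Lemma 2.1 (DISCLOSED DEVIATION of bookkeeping, not of statement)); the first family `atGreen₂` (= `B4Thm110RegionLp.atGreen`
of `Ω₀` at the cubes interior to `Ω`, the sub-region Green's function `cubeGreenI` with `A` elsewhere) and
`atGreen₂_mul`.  §2 the weight cut across `∂Ω` (`cOmega`), read on an interior cube's box (`cOmega_boxEmb`: no cut) and
on a cube's sub-region (`cOmega_incl`: the cut of the sub-pair), complement degrees (`cdeg_cOmega_ge`); the second
family **`atGreenΩ`**: at a cube interior to `Ω` the padded box Green's function of `Ã_j` plus the harmless diagonal
of the doubly-cut operator, at any other cube the padded `B4RegionPairGreen.pairGreen` of the sub-pair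
`(Ω₀ ∩ □̂_j, Ω ∩ □̂_j)` with `A`; **`atGreenΩ_mul`** (it inverts the doubly-cut cube operator, every cube, every
configuration).  §3 at the cubes interior to `Ω` the letters `h_jG_j^Ωh_j`, `K_jG_j^Ωh_j` ARE the letters of the
first family (`letterΩ_a_eq`, `letterΩ_b_eq`: both are paddings of the box letters), and `‖G_j^Ω‖ ≤ max ‖G_□‖ (2/n²)`
(`norm_atGreenΩ_le`) — so every box input of `B4Thm110RegionLpDeriv.chain_letter_inputs` serves both families.
§4 at the other cubes the letter `K_jG_j^Ωh_j` is the padded letter of the sub-pair (`letterΩ_b_bad`), the object of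
Lemma 2.1 on `Ω ∩ □̂_j` and on `(Ω₀∖Ω) ∩ □̂_j`.

HONEST SCOPE.  Bookkeeping only (no estimate); abelian one-parameter flow, component fields, staircase contours; the
switch-on-`Ω` choice of cube configurations as said.  No `Prop` fact, no `sorry`; axioms standard.
-/

namespace Literature.MathematicalPhysics.QuantumFieldTheory.Balaban1983to89.B4CubeGreenRegionPair

open Literature.MathematicalPhysics.QuantumFieldTheory.Balaban1983to89.B4Reflection242 (boxDom mem_boxDom nbrs mem_nbrs
  blk blk_mem_boxDom)
open Literature.MathematicalPhysics.QuantumFieldTheory.Balaban1983to89.B4GaugeCovariance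
open Literature.MathematicalPhysics.QuantumFieldTheory.Balaban1983to89.B4Commutators25to211 (mulH opK)
open Literature.MathematicalPhysics.QuantumFieldTheory.Balaban1983to89.B4Lower18 (fineDom mem_fineDom IsBlockUnion)
open Literature.MathematicalPhysics.QuantumFieldTheory.Balaban1983to89.B4Lower18Regular (e1 baseEmb stairContour)
open Literature.MathematicalPhysics.QuantumFieldTheory.Balaban1983to89.B4Lower18RegularRegion (regWt rBlkWt rbaseEmb
  rstairContour regWt_nonneg rBlkWt_ne_zero compField)
open Literature.MathematicalPhysics.QuantumFieldTheory.Balaban1983to89.B4Lemma22ReduceZero (Box opA greenA derivA)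
open Literature.MathematicalPhysics.QuantumFieldTheory.Balaban1983to89.B4Lemma22Invertible (opA_stair_isUnit_det)
open Literature.MathematicalPhysics.QuantumFieldTheory.Balaban1983to89.B4PartitionUnity22 (hCube)
open Literature.MathematicalPhysics.QuantumFieldTheory.Balaban1983to89.B4CubeFields22 (cubeField cubeField_eq_compField)
open Literature.MathematicalPhysics.QuantumFieldTheory.Balaban1983to89.B4Eq221L2FactorRegion (acBond)
open Literature.MathematicalPhysics.QuantumFieldTheory.Balaban1983to89.B4CubeOpReindex
open Literature.MathematicalPhysics.QuantumFieldTheory.Balaban1983to89.B4WalkRouteRegion (rpos covOp_blockLocal_posDef)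
open Literature.MathematicalPhysics.QuantumFieldTheory.Balaban1983to89.B4RegionCubeCarrier
open Literature.MathematicalPhysics.QuantumFieldTheory.Balaban1983to89.B4CubeGreenRegion
open Literature.MathematicalPhysics.QuantumFieldTheory.Balaban1983to89.B4Thm110RegionLp
open Literature.MathematicalPhysics.QuantumFieldTheory.Balaban1983to89.B4RegionPairGreen
open scoped Matrix
open scoped Matrix.Norms.Operator

noncomputable section

variable {d : ℕ}

section Data

variable {ι : Type} [Fintype ι] [DecidableEq ι] (F : OrthFlow ι) (κ : ℝ)
variable (ℓ k : ℕ) (Ω₀c Ωc : Finset (Fin (d + 1) → ℤ)) (hsub : Ωc ⊆ Ω₀c) (K : ℕ)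
  (Ac : (Fin (d + 1) → ℤ) → Fin (d + 1) → ℝ)

/-- the mesh `n = L^k ≥ 1`. [folklore] -/
private theorem one_le_n : 1 ≤ (ℓ + 1) ^ k := Nat.one_le_pow _ _ (Nat.succ_pos ℓ)

/-! ## §1. Cube configurations with the switch on `Ω`; the first family `G_j` -/

/-- **THE CUBE CONFIGURATIONS OF THE PAIR**: `Ã_j` (p35's `cubeField` on the sites of `Ω₀`) at a cube interior to
`Ω`, `A` at every other cube. [cite: Balaban1983RegularityDecay, (2.2) p.575 «if □_j is an interior cube of Ω, then … Ã_j», (1.11) p.573] -/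
def atField₂ (j : Fin (d + 1) → ℤ) : ↥(fineDom ((ℓ + 1) ^ k) Ω₀c) → ↥(fineDom ((ℓ + 1) ^ k) Ω₀c) → ℝ :=
  if cubeLabels K j ⊆ Ωc then atField ℓ k Ω₀c K Ac j else acBond Ω₀c Ac

omit [Fintype ι] [DecidableEq ι] in
/-- at a cube interior to `Ω` the pair's configuration is `Ω₀`'s `Ã_j`. [cite: Balaban1983RegularityDecay, (2.2) p.575] -/
theorem atField₂_good {j : Fin (d + 1) → ℤ} (h : cubeLabels K j ⊆ Ωc) :
    atField₂ ℓ k Ω₀c Ωc K Ac j = atField ℓ k Ω₀c K Ac j := if_pos h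

omit [Fintype ι] [DecidableEq ι] in
/-- at any other cube the pair's configuration is `A`. [cite: Balaban1983RegularityDecay, (2.2) p.575] -/
theorem atField₂_bad {j : Fin (d + 1) → ℤ} (h : ¬ cubeLabels K j ⊆ Ωc) :
    atField₂ ℓ k Ω₀c Ωc K Ac j = acBond Ω₀c Ac := if_neg h

omit [Fintype ι] [DecidableEq ι] in
/-- on two sites of the `¾M`-core of `□_j` the pair's configuration is `A`. [cite: Balaban1983RegularityDecay, §2 p.575 «Ã_j … equal to A on … |x − Mj| ≤ ¾M»] -/
theorem atField₂_core {K : ℕ} (hK : 1 ≤ K) (j : Fin (d + 1) → ℤ) (u v : ↥(fineDom ((ℓ + 1) ^ k) Ω₀c))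
    (hu : ∀ μ, |rpos ((ℓ + 1) ^ k) Ω₀c u μ - ((((ℓ + 1) ^ k : ℕ) : ℝ) * K) * j μ|
      ≤ 3 / 4 * ((((ℓ + 1) ^ k : ℕ) : ℝ) * K))
    (hv : ∀ μ, |rpos ((ℓ + 1) ^ k) Ω₀c v μ - ((((ℓ + 1) ^ k : ℕ) : ℝ) * K) * j μ|
      ≤ 3 / 4 * ((((ℓ + 1) ^ k : ℕ) : ℝ) * K)) :
    atField₂ ℓ k Ω₀c Ωc K Ac j u v = acBond Ω₀c Ac u v := by
  by_cases h : cubeLabels K j ⊆ Ωc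
  · rw [atField₂_good ℓ k Ω₀c Ωc K Ac h]
    exact atField_core ℓ k Ω₀c Ac hK j u v hu hv
  · rw [atField₂_bad ℓ k Ω₀c Ωc K Ac h]

/-- **THE FIRST FAMILY `G_j = G_k(□_j, A_j)`** (operator of `Ω₀` cut at `∂□_j`): `Ω₀`'s `atGreen` at a cube interior to
`Ω`, the padded Green's function of the sub-region `Ω₀ ∩ □̂_j` with `A` at every other cube.
[cite: Balaban1983RegularityDecay, (2.2) p.575, (2.13) p.577, (1.11) p.573] -/
def atGreen₂ (a m2 : ℝ) (j : Fin (d + 1) → ℤ) :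
    Matrix (↥(fineDom ((ℓ + 1) ^ k) Ω₀c) × ι) (↥(fineDom ((ℓ + 1) ^ k) Ω₀c) × ι) ℝ :=
  if h : cubeLabels K j ⊆ Ωc then cubeGreenB F κ ℓ k Ω₀c K a m2 (atField ℓ k Ω₀c K Ac j) (h.trans hsub)
  else cubeGreenI F κ ℓ k Ω₀c K m2
    (B1.aSeq a ((ℓ : ℝ) + 1) k * (((((ℓ + 1) ^ k : ℕ)) : ℝ) ^ (d + 1))⁻¹) (acBond Ω₀c Ac) j

/-- at a cube interior to `Ω`, `G_j` is `Ω₀`'s `atGreen`. [cite: Balaban1983RegularityDecay, (2.2) p.575] -/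
theorem atGreen₂_good (a m2 : ℝ) {j : Fin (d + 1) → ℤ} (h : cubeLabels K j ⊆ Ωc) :
    atGreen₂ F κ ℓ k Ω₀c Ωc hsub K Ac a m2 j = atGreen F κ ℓ k Ω₀c K Ac a m2 j := by
  rw [atGreen₂, dif_pos h, atGreen_good F κ ℓ k Ω₀c K Ac a m2 (h.trans hsub)]

/-- at any other cube, `G_j` is the padded sub-region Green's function with `A`. [cite: Balaban1983RegularityDecay, (2.2) p.575] -/
theorem atGreen₂_bad (a m2 : ℝ) {j : Fin (d + 1) → ℤ} (h : ¬ cubeLabels K j ⊆ Ωc) :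
    atGreen₂ F κ ℓ k Ω₀c Ωc hsub K Ac a m2 j = cubeGreenI F κ ℓ k Ω₀c K m2
      (B1.aSeq a ((ℓ : ℝ) + 1) k * (((((ℓ + 1) ^ k : ℕ)) : ℝ) ^ (d + 1))⁻¹) (acBond Ω₀c Ac) j := by
  rw [atGreen₂, dif_neg h]

/-- **`hGj` FOR THE PAIR**: the cube operator of `Ω₀` cut at `∂□_j` (data of `atField₂ j`, null off the cube) times
`G_j` is the identity — every cube, every configuration. [cite: Balaban1983RegularityDecay, (2.2) p.575, (2.6) p.576] -/
theorem atGreen₂_mul (hℓ : 1 ≤ ℓ) (hk : 1 ≤ k) {a m2 : ℝ} (ha : 0 < a) (hm : 0 ≤ m2) (j : Fin (d + 1) → ℤ) :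
    covOp (cutWt (cubeS ℓ k Ω₀c K j) (regWt ((ℓ + 1) ^ k) (fineDom ((ℓ + 1) ^ k) Ω₀c))) m2
        (B1.aSeq a ((ℓ : ℝ) + 1) k * (((((ℓ + 1) ^ k : ℕ)) : ℝ) ^ (d + 1))⁻¹)
        (rBlkWt ((ℓ + 1) ^ k) Ω₀c (fineDom ((ℓ + 1) ^ k) Ω₀c))
        (cubeW F κ ℓ k Ω₀c K (atField₂ ℓ k Ω₀c Ωc K Ac j) j) (cubeT F κ ℓ k Ω₀c K (atField₂ ℓ k Ω₀c Ωc K Ac j) j)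
      * atGreen₂ F κ ℓ k Ω₀c Ωc hsub K Ac a m2 j = 1 := by
  by_cases h : cubeLabels K j ⊆ Ωc
  · rw [atField₂_good ℓ k Ω₀c Ωc K Ac h, atGreen₂_good F κ ℓ k Ω₀c Ωc hsub K Ac a m2 h]
    exact atGreen_mul F κ ℓ k Ω₀c K Ac hℓ hk ha hm j
  · rw [atField₂_bad ℓ k Ω₀c Ωc K Ac h, atGreen₂_bad F κ ℓ k Ω₀c Ωc hsub K Ac a m2 h]
    have hn2 : 2 ≤ (ℓ + 1) ^ k := by
      calc 2 ≤ ℓ + 1 := by omega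
        _ = (ℓ + 1) ^ 1 := (pow_one _).symm
        _ ≤ (ℓ + 1) ^ k := Nat.pow_le_pow_right (Nat.succ_pos ℓ) hk
    have hL : (1 : ℝ) < (ℓ : ℝ) + 1 := by
      have : (1 : ℝ) ≤ ℓ := by exact_mod_cast hℓ
      linarith
    have hak : 0 < B1.aSeq a ((ℓ : ℝ) + 1) k * (((((ℓ + 1) ^ k : ℕ)) : ℝ) ^ (d + 1))⁻¹ := by
      have := B1.aSeq_pos ha hL hk
      positivity
    exact cubeOp_mul_cubeGreenI F κ ℓ k Ω₀c K hak hm hn2 _ j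

/-! ## §2. The weight cut across `∂Ω`; the second family `G_j^Ω` -/

/-- **THE BOND WEIGHTS OF `Ω₀` CUT ACROSS `∂Ω`** (the operator `H_k(Ω,A) ⊕ H_k(Ω₀∖Ω,A)` of (1.11) on one carrier).
[cite: Balaban1983RegularityDecay, (1.11) p.573, (1.3) p.572] -/
abbrev cOmega : ↥(fineDom ((ℓ + 1) ^ k) Ω₀c) → ↥(fineDom ((ℓ + 1) ^ k) Ω₀c) → ℝ :=
  cutWt (inReg ((ℓ + 1) ^ k) Ωc) (regWt ((ℓ + 1) ^ k) (fineDom ((ℓ + 1) ^ k) Ω₀c))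

omit [Fintype ι] [DecidableEq ι] in
/-- the unit label of an embedded box site is the translated label. [cite: Balaban1983RegularityDecay, (1.1) p.572, dictionary] -/
theorem blk_boxEmb {Ms : Fin (d + 1) → ℕ} {o : Fin (d + 1) → ℤ} (ho : ∀ y : ↥(boxDom Ms), (y.1 + o) ∈ Ω₀c)
    (a : ↥(Box d ℓ k Ms)) : blk ((ℓ + 1) ^ k) (boxEmb ℓ k Ms o ho a).1 = blk ((ℓ + 1) ^ k) a.1 + o := by
  have hn0 : ((((ℓ + 1) ^ k : ℕ)) : ℤ) ≠ 0 := by exact_mod_cast (Nat.pos_iff_ne_zero.mp (one_le_n ℓ k))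
  funext ν
  show (a.1 ν + (((ℓ + 1) ^ k : ℕ) : ℤ) * o ν) / ((((ℓ + 1) ^ k : ℕ)) : ℤ) = a.1 ν / ((((ℓ + 1) ^ k : ℕ)) : ℤ) + o ν
  rw [mul_comm, Int.add_mul_ediv_right _ _ hn0]

omit [Fintype ι] [DecidableEq ι] in
/-- an embedded site of a cube interior to `Ω` lies in `Ω`. [cite: Balaban1983RegularityDecay, (2.2) p.575] -/
theorem inReg_boxEmb {j : Fin (d + 1) → ℤ} (hgood : cubeLabels K j ⊆ Ωc)
    (a : ↥(Box d ℓ k fun _ : Fin (d + 1) => 2 * K)) :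
    inReg ((ℓ + 1) ^ k) Ωc (boxEmb ℓ k (fun _ => 2 * K) (cshift K j) (shift_mem_of_cube_subset (hgood.trans hsub)) a) := by
  unfold inReg
  rw [blk_boxEmb]
  exact shift_mem_of_cube_subset hgood ⟨blk ((ℓ + 1) ^ k) a.1, blk_mem_boxDom (one_le_n ℓ k) a.2⟩

omit [Fintype ι] [DecidableEq ι] in
/-- **NO CUT INSIDE A CUBE INTERIOR TO `Ω`**: read on the box of `□̂_j ⊆ Ω` the weight cut across `∂Ω` is `Ω₀`'s weight.
[cite: Balaban1983RegularityDecay, (1.11) p.573, (2.2) p.575] -/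
theorem cOmega_boxEmb {j : Fin (d + 1) → ℤ} (hgood : cubeLabels K j ⊆ Ωc) :
    (fun a b : ↥(Box d ℓ k fun _ : Fin (d + 1) => 2 * K) =>
        cOmega ℓ k Ω₀c Ωc (boxEmb ℓ k (fun _ => 2 * K) (cshift K j) (shift_mem_of_cube_subset (hgood.trans hsub)) a)
          (boxEmb ℓ k (fun _ => 2 * K) (cshift K j) (shift_mem_of_cube_subset (hgood.trans hsub)) b))
      = fun a b => regWt ((ℓ + 1) ^ k) (fineDom ((ℓ + 1) ^ k) Ω₀c)
          (boxEmb ℓ k (fun _ => 2 * K) (cshift K j) (shift_mem_of_cube_subset (hgood.trans hsub)) a)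
          (boxEmb ℓ k (fun _ => 2 * K) (cshift K j) (shift_mem_of_cube_subset (hgood.trans hsub)) b) := by
  funext a b
  simp only [cOmega, cutWt, if_pos (iff_of_true (inReg_boxEmb ℓ k Ω₀c Ωc hsub K hgood a)
    (inReg_boxEmb ℓ k Ω₀c Ωc hsub K hgood b))]

omit [Fintype ι] [DecidableEq ι] in
/-- **ON A CUBE's SUB-REGION THE CUT ACROSS `∂Ω` IS THE CUT OF THE SUB-PAIR** `(Ω₀ ∩ □̂_j, Ω ∩ □̂_j)`.
[cite: Balaban1983RegularityDecay, (1.11) p.573, §2 p.575 «□_j = Ω ∩ {…}»] -/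
theorem cOmega_incl (j : Fin (d + 1) → ℤ) :
    (fun a b : ↥(fineDom ((ℓ + 1) ^ k) (subLabels Ω₀c K j)) =>
        cOmega ℓ k Ω₀c Ωc (incl (one_le_n ℓ k) (subLabels_subset Ω₀c K j) a)
          (incl (one_le_n ℓ k) (subLabels_subset Ω₀c K j) b))
      = cutWt (inReg ((ℓ + 1) ^ k) (Ωc ∩ cubeLabels K j))
          (regWt ((ℓ + 1) ^ k) (fineDom ((ℓ + 1) ^ k) (subLabels Ω₀c K j))) := by
  have hn := one_le_n ℓ k
  have hiff : ∀ a : ↥(fineDom ((ℓ + 1) ^ k) (subLabels Ω₀c K j)),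
      inReg ((ℓ + 1) ^ k) Ωc (incl hn (subLabels_subset Ω₀c K j) a) ↔ inReg ((ℓ + 1) ^ k) (Ωc ∩ cubeLabels K j) a := by
    intro a
    have ha : blk ((ℓ + 1) ^ k) a.1 ∈ subLabels Ω₀c K j := (mem_fineDom hn).1 a.2
    unfold inReg
    show blk ((ℓ + 1) ^ k) a.1 ∈ Ωc ↔ blk ((ℓ + 1) ^ k) a.1 ∈ Ωc ∩ cubeLabels K j
    rw [Finset.mem_inter]
    exact ⟨fun h => ⟨h, (Finset.mem_inter.mp ha).2⟩, fun h => h.1⟩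
  funext a b
  simp only [cOmega, cutWt, hiff]
  rfl

omit [Fintype ι] [DecidableEq ι] in
/-- a lattice point has a nearest neighbour in its own `n`-block (`n ≥ 2`). [folklore] -/
private theorem exists_nbr_same_blk {n : ℕ} (hn : 2 ≤ n) (z : Fin (d + 1) → ℤ) (i : Fin (d + 1)) :
    ∃ z', z' ∈ nbrs z ∧ blk n z' = blk n z := by
  have hn0 : (0 : ℤ) < n := by exact_mod_cast (by omega : 0 < n)
  have hr0 := Int.emod_nonneg (z i) hn0.ne'
  have hr1 := Int.emod_lt_of_pos (z i) hn0
  have hdiv := Int.mul_ediv_add_emod (z i) (n : ℤ)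
  by_cases hup : z i % n + 1 < n
  · refine ⟨z + e1 i, mem_nbrs.2 ⟨i, Or.inl rfl⟩, funext fun l => ?_⟩
    by_cases hl : l = i
    · subst hl
      simp only [blk, Pi.add_apply, B4Lower18Regular.e1_apply_self]
      exact ((Int.ediv_emod_unique (a := z l + 1) (b := (n : ℤ)) (r := z l % n + 1) (q := z l / n) hn0).2
        ⟨by linarith, by linarith, hup⟩).1
    · simp only [blk, Pi.add_apply, B4Lower18Regular.e1_apply_ne hl, add_zero]
  · refine ⟨z - e1 i, mem_nbrs.2 ⟨i, Or.inr rfl⟩, funext fun l => ?_⟩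
    by_cases hl : l = i
    · subst hl
      simp only [blk, Pi.sub_apply, B4Lower18Regular.e1_apply_self]
      have hn2 : (2 : ℤ) ≤ n := by exact_mod_cast hn
      exact ((Int.ediv_emod_unique (a := z l - 1) (b := (n : ℤ)) (r := z l % n - 1) (q := z l / n) hn0).2
        ⟨by linarith, by linarith, by linarith⟩).1
    · simp only [blk, Pi.sub_apply, B4Lower18Regular.e1_apply_ne hl, sub_zero]

omit [Fintype ι] [DecidableEq ι] in
/-- **COMPLEMENT DEGREES OF THE DOUBLY-CUT OPERATOR**: off the cube every site keeps a nearest neighbour of its own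
unit block (same side of `∂Ω`, off the cube), so its outgoing doubly-cut weight is `≥ n²/2`.
[cite: Balaban1983RegularityDecay, (1.3) p.572, dictionary] -/
theorem cdeg_cOmega_ge (hn2 : 2 ≤ (ℓ + 1) ^ k) (j : Fin (d + 1) → ℤ) {z : ↥(fineDom ((ℓ + 1) ^ k) Ω₀c)}
    (hz : ¬ cubeS ℓ k Ω₀c K j z) :
    ((((ℓ + 1) ^ k : ℕ) : ℝ)) ^ 2 / 2 ≤ cdeg (cubeS ℓ k Ω₀c K j) (cOmega ℓ k Ω₀c Ωc) z := by
  classical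
  have hn := one_le_n ℓ k
  obtain ⟨w, hw, hblk⟩ := exists_nbr_same_blk hn2 z.1 0
  have hwmem : w ∈ fineDom ((ℓ + 1) ^ k) Ω₀c := by
    rw [mem_fineDom hn, hblk]
    exact (mem_fineDom hn).1 z.2
  set z' : ↥(fineDom ((ℓ + 1) ^ k) Ω₀c) := ⟨w, hwmem⟩ with hz'
  have hz'out : ¬ cubeS ℓ k Ω₀c K j z' := fun h =>
    hz ((inBox_iff_of_blk_eq (cshift K j) (fun _ => 2 * K) (z := z) (z' := z') hblk.symm).mpr h)
  have hreg : (inReg ((ℓ + 1) ^ k) Ωc z ↔ inReg ((ℓ + 1) ^ k) Ωc z') := by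
    unfold inReg; rw [show blk ((ℓ + 1) ^ k) z'.1 = blk ((ℓ + 1) ^ k) z.1 from hblk]
  have hterm : cutWt (cubeS ℓ k Ω₀c K j) (cOmega ℓ k Ω₀c Ωc) z z' = ((((ℓ + 1) ^ k : ℕ) : ℝ)) ^ 2 / 2 := by
    simp only [cOmega, cutWt, if_pos (iff_of_false hz hz'out), if_pos hreg]
    unfold regWt
    rw [if_pos hw, mul_one]
  have hnonneg : ∀ y, 0 ≤ cutWt (cubeS ℓ k Ω₀c K j) (cOmega ℓ k Ω₀c Ωc) z y := by
    intro y
    simp only [cOmega, cutWt]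
    split_ifs
    · exact regWt_nonneg _ _ z y
    · exact le_rfl
    · exact le_rfl
  rw [← hterm]
  exact Finset.single_le_sum (f := fun y => cutWt (cubeS ℓ k Ω₀c K j) (cOmega ℓ k Ω₀c Ωc) z y)
    (fun y _ => hnonneg y) (Finset.mem_univ z')

omit [Fintype ι] [DecidableEq ι] in
/-- the labels of a cube's sub-pair: `Ω ∩ □̂_j ⊆ Ω₀ ∩ □̂_j`. [cite: Balaban1983RegularityDecay, (1.11) p.573, §2 p.575] -/
theorem inter_subset_subLabels (h : Ωc ⊆ Ω₀c) (j : Fin (d + 1) → ℤ) : Ωc ∩ cubeLabels K j ⊆ subLabels Ω₀c K j :=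
  Finset.inter_subset_inter h le_rfl

/-- **THE SECOND FAMILY `G_j^Ω`** (operator of `Ω₀` cut at `∂□_j` AND across `∂Ω`): at a cube interior to `Ω` the
padded box Green's function of `Ã_j` plus the harmless diagonal of the doubly-cut operator; at any other cube the
padded Green's function `pad(G_k(Ω∩□̂_j,A)) + pad(G_k((Ω₀∖Ω)∩□̂_j,A))` of the sub-pair plus the harmless diagonal.
[cite: Balaban1983RegularityDecay, (1.11) p.573, (2.2) p.575, (2.13) p.577] -/
def atGreenΩ (a m2 : ℝ) (j : Fin (d + 1) → ℤ) :
    Matrix (↥(fineDom ((ℓ + 1) ^ k) Ω₀c) × ι) (↥(fineDom ((ℓ + 1) ^ k) Ω₀c) × ι) ℝ :=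
  if h : cubeLabels K j ⊆ Ωc then
    pad (boxEmb ℓ k (fun _ => 2 * K) (cshift K j) (shift_mem_of_cube_subset (h.trans hsub)))
        (greenA d F κ ℓ k a m2 (fun _ => 2 * K) (baseEmb (one_le_n ℓ k) _) (stairContour (one_le_n ℓ k) _)
          (subFieldB ℓ k Ω₀c K (h.trans hsub) (atField ℓ k Ω₀c K Ac j)))
      + cinv (cubeS ℓ k Ω₀c K j) (cOmega ℓ k Ω₀c Ωc) m2
  else
    pad (incl (one_le_n ℓ k) (subLabels_subset Ω₀c K j))
        (pairGreen F κ (one_le_n ℓ k) (subLabels Ω₀c K j) (Ωc ∩ cubeLabels K j)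
          (inter_subset_subLabels Ω₀c Ωc K hsub j) m2
          (B1.aSeq a ((ℓ : ℝ) + 1) k * (((((ℓ + 1) ^ k : ℕ)) : ℝ) ^ (d + 1))⁻¹) (compField Ac))
      + cinv (cubeS ℓ k Ω₀c K j) (cOmega ℓ k Ω₀c Ωc) m2

/-- `G_j^Ω` at a cube interior to `Ω`. [cite: Balaban1983RegularityDecay, (1.11) p.573, (2.2) p.575] -/
theorem atGreenΩ_good (a m2 : ℝ) {j : Fin (d + 1) → ℤ} (h : cubeLabels K j ⊆ Ωc) :
    atGreenΩ F κ ℓ k Ω₀c Ωc hsub K Ac a m2 j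
      = pad (boxEmb ℓ k (fun _ => 2 * K) (cshift K j) (shift_mem_of_cube_subset (h.trans hsub)))
          (greenA d F κ ℓ k a m2 (fun _ => 2 * K) (baseEmb (one_le_n ℓ k) _) (stairContour (one_le_n ℓ k) _)
            (subFieldB ℓ k Ω₀c K (h.trans hsub) (atField ℓ k Ω₀c K Ac j)))
        + cinv (cubeS ℓ k Ω₀c K j) (cOmega ℓ k Ω₀c Ωc) m2 := by
  rw [atGreenΩ, dif_pos h]

/-- `G_j^Ω` at any other cube. [cite: Balaban1983RegularityDecay, (1.11) p.573, (2.2) p.575] -/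
theorem atGreenΩ_bad (a m2 : ℝ) {j : Fin (d + 1) → ℤ} (h : ¬ cubeLabels K j ⊆ Ωc) :
    atGreenΩ F κ ℓ k Ω₀c Ωc hsub K Ac a m2 j
      = pad (incl (one_le_n ℓ k) (subLabels_subset Ω₀c K j))
          (pairGreen F κ (one_le_n ℓ k) (subLabels Ω₀c K j) (Ωc ∩ cubeLabels K j)
            (inter_subset_subLabels Ω₀c Ωc K hsub j) m2
            (B1.aSeq a ((ℓ : ℝ) + 1) k * (((((ℓ + 1) ^ k : ℕ)) : ℝ) ^ (d + 1))⁻¹) (compField Ac))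
        + cinv (cubeS ℓ k Ω₀c K j) (cOmega ℓ k Ω₀c Ωc) m2 := by
  rw [atGreenΩ, dif_neg h]

/-- **THE DOUBLY-CUT DATA RESTRICTED TO A CUBE's SUB-REGION** are the data of the sub-pair's cut operator with `A`.
[cite: Balaban1983RegularityDecay, (2.6) p.576, (1.11) p.573] -/
theorem subDataΩ_eq_incl (m2 a' : ℝ) (j : Fin (d + 1) → ℤ) :
    covOp (fun b b' => cOmega ℓ k Ω₀c Ωc
        (incl (one_le_n ℓ k) (subLabels_subset Ω₀c K j) b) (incl (one_le_n ℓ k) (subLabels_subset Ω₀c K j) b')) m2 a'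
      (fun y' b => rBlkWt ((ℓ + 1) ^ k) Ω₀c (fineDom ((ℓ + 1) ^ k) Ω₀c) (inclY (subLabels_subset Ω₀c K j) y')
        (incl (one_le_n ℓ k) (subLabels_subset Ω₀c K j) b))
      (fun b b' => cubeW F κ ℓ k Ω₀c K (acBond Ω₀c Ac) j (incl (one_le_n ℓ k) (subLabels_subset Ω₀c K j) b)
        (incl (one_le_n ℓ k) (subLabels_subset Ω₀c K j) b'))
      (fun y' b => cubeT F κ ℓ k Ω₀c K (acBond Ω₀c Ac) j (inclY (subLabels_subset Ω₀c K j) y')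
        (incl (one_le_n ℓ k) (subLabels_subset Ω₀c K j) b))
      = covOp (cutWt (inReg ((ℓ + 1) ^ k) (Ωc ∩ cubeLabels K j))
            (regWt ((ℓ + 1) ^ k) (fineDom ((ℓ + 1) ^ k) (subLabels Ω₀c K j)))) m2 a'
          (rBlkWt ((ℓ + 1) ^ k) (subLabels Ω₀c K j) (fineDom ((ℓ + 1) ^ k) (subLabels Ω₀c K j)))
          (fieldLink F κ (fun u v : ↥(fineDom ((ℓ + 1) ^ k) (subLabels Ω₀c K j)) => compField Ac u.1 v.1))
          (contourTrans (fieldLink F κ (fun u v : ↥(fineDom ((ℓ + 1) ^ k) (subLabels Ω₀c K j)) => compField Ac u.1 v.1))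
            (rbaseEmb (one_le_n ℓ k) (subLabels Ω₀c K j)) (rstairContour (one_le_n ℓ k) (subLabels Ω₀c K j))) := by
  have hW : (fun b b' => cubeW F κ ℓ k Ω₀c K (acBond Ω₀c Ac) j (incl (one_le_n ℓ k) (subLabels_subset Ω₀c K j) b)
      (incl (one_le_n ℓ k) (subLabels_subset Ω₀c K j) b'))
      = fieldLink F κ (fun u v : ↥(fineDom ((ℓ + 1) ^ k) (subLabels Ω₀c K j)) => compField Ac u.1 v.1) := by
    funext b b'
    show (if cubeS ℓ k Ω₀c K j _ ∧ cubeS ℓ k Ω₀c K j _ then _ else _) = _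
    rw [if_pos ⟨cubeS_incl ℓ k Ω₀c K j b, cubeS_incl ℓ k Ω₀c K j b'⟩]
    rfl
  have hT : (fun y' b => cubeT F κ ℓ k Ω₀c K (acBond Ω₀c Ac) j (inclY (subLabels_subset Ω₀c K j) y')
      (incl (one_le_n ℓ k) (subLabels_subset Ω₀c K j) b))
      = contourTrans (fieldLink F κ (fun u v : ↥(fineDom ((ℓ + 1) ^ k) (subLabels Ω₀c K j)) => compField Ac u.1 v.1))
          (rbaseEmb (one_le_n ℓ k) (subLabels Ω₀c K j)) (rstairContour (one_le_n ℓ k) (subLabels Ω₀c K j)) := by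
    funext y' b
    show (if cubeS ℓ k Ω₀c K j _ then _ else _) = _
    rw [if_pos (cubeS_incl ℓ k Ω₀c K j b)]
    exact contourTrans_incl (one_le_n ℓ k) (subLabels_subset Ω₀c K j) F κ (acBond Ω₀c Ac) y' b
  rw [hW, hT, cOmega_incl]
  rfl

/-- **`hGjΩ` FOR THE PAIR**: the doubly-cut cube operator (cut at `∂□_j` and across `∂Ω`; data of `atField₂ j`, null off
the cube) times `G_j^Ω` is the identity — every cube, every configuration (`a > 0`, `m² ≥ 0`).
[cite: Balaban1983RegularityDecay, (1.11) p.573, (2.2) p.575, (2.6) p.576] -/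
theorem atGreenΩ_mul (hℓ : 1 ≤ ℓ) (hk : 1 ≤ k) {a m2 : ℝ} (ha : 0 < a) (hm : 0 ≤ m2) (j : Fin (d + 1) → ℤ) :
    covOp (cutWt (cubeS ℓ k Ω₀c K j) (cOmega ℓ k Ω₀c Ωc)) m2
        (B1.aSeq a ((ℓ : ℝ) + 1) k * (((((ℓ + 1) ^ k : ℕ)) : ℝ) ^ (d + 1))⁻¹)
        (rBlkWt ((ℓ + 1) ^ k) Ω₀c (fineDom ((ℓ + 1) ^ k) Ω₀c))
        (cubeW F κ ℓ k Ω₀c K (atField₂ ℓ k Ω₀c Ωc K Ac j) j) (cubeT F κ ℓ k Ω₀c K (atField₂ ℓ k Ω₀c Ωc K Ac j) j)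
      * atGreenΩ F κ ℓ k Ω₀c Ωc hsub K Ac a m2 j = 1 := by
  have hn := one_le_n ℓ k
  have hn2 : 2 ≤ (ℓ + 1) ^ k := by
    calc 2 ≤ ℓ + 1 := by omega
      _ = (ℓ + 1) ^ 1 := (pow_one _).symm
      _ ≤ (ℓ + 1) ^ k := Nat.pow_le_pow_right (Nat.succ_pos ℓ) hk
  have hn0 : (0 : ℝ) < ((((ℓ + 1) ^ k : ℕ) : ℝ)) := by exact_mod_cast hn
  have hL : (1 : ℝ) < (ℓ : ℝ) + 1 := by
    have : (1 : ℝ) ≤ ℓ := by exact_mod_cast hℓ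
    linarith
  have hak : 0 < B1.aSeq a ((ℓ : ℝ) + 1) k * (((((ℓ + 1) ^ k : ℕ)) : ℝ) ^ (d + 1))⁻¹ := by
    have := B1.aSeq_pos ha hL hk
    positivity
  have hdeg : ∀ z, ¬ cubeS ℓ k Ω₀c K j z → cdeg (cubeS ℓ k Ω₀c K j) (cOmega ℓ k Ω₀c Ωc) z + m2 ≠ 0 := by
    intro z hz
    have := cdeg_cOmega_ge ℓ k Ω₀c Ωc K hn2 j hz
    have : (0 : ℝ) < ((((ℓ + 1) ^ k : ℕ) : ℝ)) ^ 2 / 2 := by positivity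
    linarith
  by_cases h : cubeLabels K j ⊆ Ωc
  · rw [atField₂_good ℓ k Ω₀c Ωc K Ac h, atGreenΩ_good F κ ℓ k Ω₀c Ωc hsub K Ac a m2 h]
    refine covOp_cut_mul_padInv (cubeS ℓ k Ω₀c K j)
      (boxEmb_injective ℓ k (fun _ => 2 * K) (cshift K j) (shift_mem_of_cube_subset (h.trans hsub)))
      (cubeS_iff_boxEmb ℓ k Ω₀c K (h.trans hsub))
      (boxEmbY_injective (fun _ => 2 * K) (cshift K j) (shift_mem_of_cube_subset (h.trans hsub))) _ m2 _ _ _ _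
      (fun y b hb => rBlkWt_boxEmb_ne_zero ℓ k (fun _ => 2 * K) (cshift K j) (shift_mem_of_cube_subset (h.trans hsub)) hb)
      (fun y z z' hz hz' => inBox_iff_of_rBlkWt _ _ hz hz') (fun z z' hz _ => ?_) (fun y z hz _ => ?_) hdeg ?_
    · exact if_neg (fun h' : cubeS ℓ k Ω₀c K j z ∧ cubeS ℓ k Ω₀c K j z' => hz h'.1)
    · exact if_neg hz
    · rw [cOmega_boxEmb ℓ k Ω₀c Ωc hsub K h, subData_eq_box]
      exact Matrix.mul_nonsing_inv _ (opA_stair_isUnit_det F κ hℓ hk hn ha hm _ _)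
  · rw [atField₂_bad ℓ k Ω₀c Ωc K Ac h, atGreenΩ_bad F κ ℓ k Ω₀c Ωc hsub K Ac a m2 h]
    refine covOp_cut_mul_padInv (cubeS ℓ k Ω₀c K j) (incl_injective hn (subLabels_subset Ω₀c K j))
      (cubeS_iff_incl ℓ k Ω₀c K j) (inclY_injective (subLabels_subset Ω₀c K j)) _ m2 _ _ _ _
      (fun y b hb => rBlkWt_incl_ne_zero hn (subLabels_subset Ω₀c K j) hb)
      (fun y z z' hz hz' => inBox_iff_of_rBlkWt _ _ hz hz') (fun z z' hz _ => ?_) (fun y z hz _ => ?_) hdeg ?_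
    · exact if_neg (fun h' : cubeS ℓ k Ω₀c K j z ∧ cubeS ℓ k Ω₀c K j z' => hz h'.1)
    · exact if_neg hz
    · rw [subDataΩ_eq_incl]
      exact covOpCut_mul_pairGreen F κ hn (subLabels Ω₀c K j) (Ωc ∩ cubeLabels K j)
        (inter_subset_subLabels Ω₀c Ωc K hsub j) hak hm (compField Ac)

/-! ## §3. At the cubes interior to `Ω` the letters of `G_j^Ω` are the letters of `G_j` -/

/-- **`h_jG_j^Ωh_j = h_jG_jh_j` AT A CUBE INTERIOR TO `Ω`** (`supp h ⊆ □_j`): both are the padded box letter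
`h_□G_k(□,Ã_j)h_□`. [cite: Balaban1983RegularityDecay, (2.2) p.575, (2.13) p.577, (1.11) p.573] -/
theorem letterΩ_a_eq (a m2 : ℝ) {j : Fin (d + 1) → ℤ} (hg : cubeLabels K j ⊆ Ωc)
    (h : ↥(fineDom ((ℓ + 1) ^ k) Ω₀c) → ℝ) (hh : ∀ z, h z ≠ 0 → cubeS ℓ k Ω₀c K j z) :
    mulH (ι := ι) h * atGreenΩ F κ ℓ k Ω₀c Ωc hsub K Ac a m2 j * mulH (ι := ι) h
      = mulH (ι := ι) h * atGreen F κ ℓ k Ω₀c K Ac a m2 j * mulH (ι := ι) h := by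
  have he := boxEmb_injective ℓ k (fun _ => 2 * K) (cshift K j) (shift_mem_of_cube_subset (hg.trans hsub))
  rw [atGreenΩ_good F κ ℓ k Ω₀c Ωc hsub K Ac a m2 hg, atGreen_good F κ ℓ k Ω₀c K Ac a m2 (hg.trans hsub), cubeGreenB,
    letter_a_eq_pad (cubeS ℓ k Ω₀c K j) he (cubeS_iff_boxEmb ℓ k Ω₀c K (hg.trans hsub)) _ m2 h hh,
    letter_a_eq_pad (cubeS ℓ k Ω₀c K j) he (cubeS_iff_boxEmb ℓ k Ω₀c K (hg.trans hsub)) _ m2 h hh]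

/-- **`K_j^ΩG_j^Ωh_j = K_jG_jh_j` AT A CUBE INTERIOR TO `Ω`** (`K_j^Ω` the commutator (2.10) of the doubly-cut operator):
both are the padded box letter `K_{h_□}G_k(□,Ã_j)h_□` — inside `□̂_j ⊆ Ω` no bond is cut by `∂Ω`.
[cite: Balaban1983RegularityDecay, (2.11) p.576, (2.13) p.577, (1.11) p.573] -/
theorem letterΩ_b_eq (a m2 : ℝ) {j : Fin (d + 1) → ℤ} (hg : cubeLabels K j ⊆ Ωc)
    (h : ↥(fineDom ((ℓ + 1) ^ k) Ω₀c) → ℝ) (hh : ∀ z, h z ≠ 0 → cubeS ℓ k Ω₀c K j z) :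
    opK (cutWt (cubeS ℓ k Ω₀c K j) (cOmega ℓ k Ω₀c Ωc)) m2
        (B1.aSeq a ((ℓ : ℝ) + 1) k * (((((ℓ + 1) ^ k : ℕ)) : ℝ) ^ (d + 1))⁻¹)
        (rBlkWt ((ℓ + 1) ^ k) Ω₀c (fineDom ((ℓ + 1) ^ k) Ω₀c))
        (cubeW F κ ℓ k Ω₀c K (atField₂ ℓ k Ω₀c Ωc K Ac j) j) (cubeT F κ ℓ k Ω₀c K (atField₂ ℓ k Ω₀c Ωc K Ac j) j) h
      * atGreenΩ F κ ℓ k Ω₀c Ωc hsub K Ac a m2 j * mulH (ι := ι) h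
      = opK (cutWt (cubeS ℓ k Ω₀c K j) (regWt ((ℓ + 1) ^ k) (fineDom ((ℓ + 1) ^ k) Ω₀c))) m2
          (B1.aSeq a ((ℓ : ℝ) + 1) k * (((((ℓ + 1) ^ k : ℕ)) : ℝ) ^ (d + 1))⁻¹)
          (rBlkWt ((ℓ + 1) ^ k) Ω₀c (fineDom ((ℓ + 1) ^ k) Ω₀c))
          (cubeW F κ ℓ k Ω₀c K (atField ℓ k Ω₀c K Ac j) j) (cubeT F κ ℓ k Ω₀c K (atField ℓ k Ω₀c K Ac j) j) h
        * atGreen F κ ℓ k Ω₀c K Ac a m2 j * mulH (ι := ι) h := by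
  have he := boxEmb_injective ℓ k (fun _ => 2 * K) (cshift K j) (shift_mem_of_cube_subset (hg.trans hsub))
  have hS := cubeS_iff_boxEmb ℓ k Ω₀c K (hg.trans hsub)
  have heY := boxEmbY_injective (fun _ => 2 * K) (cshift K j) (shift_mem_of_cube_subset (hg.trans hsub))
  rw [atField₂_good ℓ k Ω₀c Ωc K Ac hg, atGreenΩ_good F κ ℓ k Ω₀c Ωc hsub K Ac a m2 hg,
    atGreen_good F κ ℓ k Ω₀c K Ac a m2 (hg.trans hsub), cubeGreenB,
    letter_b_eq_pad (cubeS ℓ k Ω₀c K j) he hS heY (cOmega ℓ k Ω₀c Ωc) m2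
      (B1.aSeq a ((ℓ : ℝ) + 1) k * (((((ℓ + 1) ^ k : ℕ)) : ℝ) ^ (d + 1))⁻¹)
      (rBlkWt ((ℓ + 1) ^ k) Ω₀c (fineDom ((ℓ + 1) ^ k) Ω₀c)) (cubeW F κ ℓ k Ω₀c K (atField ℓ k Ω₀c K Ac j) j)
      (cubeT F κ ℓ k Ω₀c K (atField ℓ k Ω₀c K Ac j) j)
      (fun y b hb => rBlkWt_boxEmb_ne_zero ℓ k (fun _ => 2 * K) (cshift K j) (shift_mem_of_cube_subset (hg.trans hsub)) hb)
      (fun y z z' hz hz' => inBox_iff_of_rBlkWt _ _ hz hz')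
      (fun z z' hz _ => if_neg (fun h' : cubeS ℓ k Ω₀c K j z ∧ cubeS ℓ k Ω₀c K j z' => hz h'.1))
      (fun y z hz _ => if_neg hz) h hh,
    letter_b_eq_pad (cubeS ℓ k Ω₀c K j) he hS heY (regWt ((ℓ + 1) ^ k) (fineDom ((ℓ + 1) ^ k) Ω₀c)) m2
      (B1.aSeq a ((ℓ : ℝ) + 1) k * (((((ℓ + 1) ^ k : ℕ)) : ℝ) ^ (d + 1))⁻¹)
      (rBlkWt ((ℓ + 1) ^ k) Ω₀c (fineDom ((ℓ + 1) ^ k) Ω₀c)) (cubeW F κ ℓ k Ω₀c K (atField ℓ k Ω₀c K Ac j) j)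
      (cubeT F κ ℓ k Ω₀c K (atField ℓ k Ω₀c K Ac j) j)
      (fun y b hb => rBlkWt_boxEmb_ne_zero ℓ k (fun _ => 2 * K) (cshift K j) (shift_mem_of_cube_subset (hg.trans hsub)) hb)
      (fun y z z' hz hz' => inBox_iff_of_rBlkWt _ _ hz hz')
      (fun z z' hz _ => if_neg (fun h' : cubeS ℓ k Ω₀c K j z ∧ cubeS ℓ k Ω₀c K j z' => hz h'.1))
      (fun y z hz _ => if_neg hz) h hh,
    cOmega_boxEmb ℓ k Ω₀c Ωc hsub K hg]

/-- **THE INPUT `γ` FOR THE SECOND FAMILY AT A CUBE INTERIOR TO `Ω`**: `‖G_j^Ω‖_{ℓ∞→ℓ∞} ≤ max ‖G_k(□,Ã_j)‖ (2/n²)`.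
[cite: Balaban1983RegularityDecay, (2.17) p.578, (1.11) p.573] -/
theorem norm_atGreenΩ_le (hn2 : 2 ≤ (ℓ + 1) ^ k) (a : ℝ) {m2 : ℝ} (hm : 0 ≤ m2) {j : Fin (d + 1) → ℤ}
    (hg : cubeLabels K j ⊆ Ωc) :
    ‖atGreenΩ F κ ℓ k Ω₀c Ωc hsub K Ac a m2 j‖
      ≤ max ‖greenA d F κ ℓ k a m2 (fun _ => 2 * K) (baseEmb (one_le_n ℓ k) _) (stairContour (one_le_n ℓ k) _)
            (subFieldB ℓ k Ω₀c K (hg.trans hsub) (atField ℓ k Ω₀c K Ac j))‖ (2 / ((((ℓ + 1) ^ k : ℕ) : ℝ)) ^ 2) := by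
  have hn := one_le_n ℓ k
  have hn0 : (0 : ℝ) < ((((ℓ + 1) ^ k : ℕ) : ℝ)) := by exact_mod_cast hn
  have hm₀ : (0 : ℝ) < ((((ℓ + 1) ^ k : ℕ) : ℝ)) ^ 2 / 2 := by positivity
  rw [atGreenΩ_good F κ ℓ k Ω₀c Ωc hsub K Ac a m2 hg]
  have h := norm_padInv_le (cubeS ℓ k Ω₀c K j)
    (boxEmb_injective ℓ k (fun _ => 2 * K) (cshift K j) (shift_mem_of_cube_subset (hg.trans hsub)))
    (cubeS_iff_boxEmb ℓ k Ω₀c K (hg.trans hsub)) (cOmega ℓ k Ω₀c Ωc) m2 hm₀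
    (fun z hz => by have := cdeg_cOmega_ge ℓ k Ω₀c Ωc K hn2 j hz; linarith)
    (greenA d F κ ℓ k a m2 (fun _ => 2 * K) (baseEmb (one_le_n ℓ k) _) (stairContour (one_le_n ℓ k) _)
      (subFieldB ℓ k Ω₀c K (hg.trans hsub) (atField ℓ k Ω₀c K Ac j)))
  rw [show (2 : ℝ) / ((((ℓ + 1) ^ k : ℕ) : ℝ)) ^ 2 = (((((ℓ + 1) ^ k : ℕ) : ℝ)) ^ 2 / 2)⁻¹ by rw [inv_div]]
  exact h

/-! ## §4. At the other cubes the letter of `G_j^Ω` is the padded letter of the sub-pair -/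

/-- the cube links restricted to the cube's sub-region are the links of the restricted configuration. [cite: Balaban1983RegularityDecay, (2.6) p.576] -/
theorem cubeW_incl (At : ↥(fineDom ((ℓ + 1) ^ k) Ω₀c) → ↥(fineDom ((ℓ + 1) ^ k) Ω₀c) → ℝ) (j : Fin (d + 1) → ℤ) :
    (fun b b' => cubeW F κ ℓ k Ω₀c K At j (incl (one_le_n ℓ k) (subLabels_subset Ω₀c K j) b)
        (incl (one_le_n ℓ k) (subLabels_subset Ω₀c K j) b'))
      = fieldLink F κ (subFieldI ℓ k Ω₀c K At j) := by
  funext b b'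
  show (if cubeS ℓ k Ω₀c K j _ ∧ cubeS ℓ k Ω₀c K j _ then _ else _) = _
  rw [if_pos ⟨cubeS_incl ℓ k Ω₀c K j b, cubeS_incl ℓ k Ω₀c K j b'⟩]
  rfl

/-- the cube transporters restricted to the cube's sub-region are the sub-region's staircase transporters. [cite: Balaban1983RegularityDecay, (2.6) p.576, (1.4) p.572] -/
theorem cubeT_incl (At : ↥(fineDom ((ℓ + 1) ^ k) Ω₀c) → ↥(fineDom ((ℓ + 1) ^ k) Ω₀c) → ℝ) (j : Fin (d + 1) → ℤ) :
    (fun y' b => cubeT F κ ℓ k Ω₀c K At j (inclY (subLabels_subset Ω₀c K j) y')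
        (incl (one_le_n ℓ k) (subLabels_subset Ω₀c K j) b))
      = contourTrans (fieldLink F κ (subFieldI ℓ k Ω₀c K At j)) (rbaseEmb (one_le_n ℓ k) (subLabels Ω₀c K j))
          (rstairContour (one_le_n ℓ k) (subLabels Ω₀c K j)) := by
  funext y' b
  show (if cubeS ℓ k Ω₀c K j _ then _ else _) = _
  rw [if_pos (cubeS_incl ℓ k Ω₀c K j b)]
  exact contourTrans_incl (one_le_n ℓ k) (subLabels_subset Ω₀c K j) F κ At y' b

/-- **`K_j^ΩG_j^Ωh_j` AT A CUBE NOT INTERIOR TO `Ω` IS THE PADDED LETTER OF THE SUB-PAIR** `(Ω₀ ∩ □̂_j, Ω ∩ □̂_j)` with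
`A`: commutator of the sub-region operator cut across `∂Ω`, times `pad(G_k(Ω∩□̂_j,A)) + pad(G_k((Ω₀∖Ω)∩□̂_j,A))`,
times `h_j` — the object of Lemma 2.1 on the two pieces. [cite: Balaban1983RegularityDecay, (2.11) p.576, (2.21) p.578, (1.11) p.573] -/
theorem letterΩ_b_bad (a m2 : ℝ) {j : Fin (d + 1) → ℤ} (hb : ¬ cubeLabels K j ⊆ Ωc)
    (h : ↥(fineDom ((ℓ + 1) ^ k) Ω₀c) → ℝ) (hh : ∀ z, h z ≠ 0 → cubeS ℓ k Ω₀c K j z) :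
    opK (cutWt (cubeS ℓ k Ω₀c K j) (cOmega ℓ k Ω₀c Ωc)) m2
        (B1.aSeq a ((ℓ : ℝ) + 1) k * (((((ℓ + 1) ^ k : ℕ)) : ℝ) ^ (d + 1))⁻¹)
        (rBlkWt ((ℓ + 1) ^ k) Ω₀c (fineDom ((ℓ + 1) ^ k) Ω₀c))
        (cubeW F κ ℓ k Ω₀c K (atField₂ ℓ k Ω₀c Ωc K Ac j) j) (cubeT F κ ℓ k Ω₀c K (atField₂ ℓ k Ω₀c Ωc K Ac j) j) h
      * atGreenΩ F κ ℓ k Ω₀c Ωc hsub K Ac a m2 j * mulH (ι := ι) h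
      = pad (incl (one_le_n ℓ k) (subLabels_subset Ω₀c K j))
          (opK (cutWt (inReg ((ℓ + 1) ^ k) (Ωc ∩ cubeLabels K j))
                (regWt ((ℓ + 1) ^ k) (fineDom ((ℓ + 1) ^ k) (subLabels Ω₀c K j)))) m2
              (B1.aSeq a ((ℓ : ℝ) + 1) k * (((((ℓ + 1) ^ k : ℕ)) : ℝ) ^ (d + 1))⁻¹)
              (rBlkWt ((ℓ + 1) ^ k) (subLabels Ω₀c K j) (fineDom ((ℓ + 1) ^ k) (subLabels Ω₀c K j)))
              (fieldLink F κ (fun u v : ↥(fineDom ((ℓ + 1) ^ k) (subLabels Ω₀c K j)) => compField Ac u.1 v.1))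
              (contourTrans
                (fieldLink F κ (fun u v : ↥(fineDom ((ℓ + 1) ^ k) (subLabels Ω₀c K j)) => compField Ac u.1 v.1))
                (rbaseEmb (one_le_n ℓ k) (subLabels Ω₀c K j)) (rstairContour (one_le_n ℓ k) (subLabels Ω₀c K j)))
              (fun b => h (incl (one_le_n ℓ k) (subLabels_subset Ω₀c K j) b))
            * pairGreen F κ (one_le_n ℓ k) (subLabels Ω₀c K j) (Ωc ∩ cubeLabels K j)
                (inter_subset_subLabels Ω₀c Ωc K hsub j) m2
                (B1.aSeq a ((ℓ : ℝ) + 1) k * (((((ℓ + 1) ^ k : ℕ)) : ℝ) ^ (d + 1))⁻¹) (compField Ac)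
            * mulH (ι := ι) (fun b => h (incl (one_le_n ℓ k) (subLabels_subset Ω₀c K j) b))) := by
  have hn := one_le_n ℓ k
  rw [atField₂_bad ℓ k Ω₀c Ωc K Ac hb, atGreenΩ_bad F κ ℓ k Ω₀c Ωc hsub K Ac a m2 hb,
    letter_b_eq_pad (cubeS ℓ k Ω₀c K j) (incl_injective hn (subLabels_subset Ω₀c K j)) (cubeS_iff_incl ℓ k Ω₀c K j)
      (inclY_injective (subLabels_subset Ω₀c K j)) (cOmega ℓ k Ω₀c Ωc) m2
      (B1.aSeq a ((ℓ : ℝ) + 1) k * (((((ℓ + 1) ^ k : ℕ)) : ℝ) ^ (d + 1))⁻¹)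
      (rBlkWt ((ℓ + 1) ^ k) Ω₀c (fineDom ((ℓ + 1) ^ k) Ω₀c)) (cubeW F κ ℓ k Ω₀c K (acBond Ω₀c Ac) j)
      (cubeT F κ ℓ k Ω₀c K (acBond Ω₀c Ac) j)
      (fun y b hb' => rBlkWt_incl_ne_zero hn (subLabels_subset Ω₀c K j) hb')
      (fun y z z' hz hz' => inBox_iff_of_rBlkWt _ _ hz hz')
      (fun z z' hz _ => if_neg (fun h' : cubeS ℓ k Ω₀c K j z ∧ cubeS ℓ k Ω₀c K j z' => hz h'.1))
      (fun y z hz _ => if_neg hz) h hh,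
    cOmega_incl ℓ k Ω₀c Ωc K j, cubeW_incl, cubeT_incl]
  rfl

end Data

end

end Literature.MathematicalPhysics.QuantumFieldTheory.Balaban1983to89.B4CubeGreenRegionPair
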